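import Summits.AtomisticToContinuum.Crystallization.Cruxes.LayeredLawsSelectHcp.Split
import Summits.AtomisticToContinuum.Crystallization.Theorems.PalmUnimodularRigidityLayeredLawsSelectHcpFarRange
import Summits.AtomisticToContinuum.Crystallization.Theorems.PalmUnimodularRigidityLayeredLawsSelectHcpSelectionDefs
import Literature.MathematicalPhysics.StatisticalMechanics.HcpSiteGeometry

/-!
# Crux `LayeredLawsSelectHcp` (stmt-AtomisticToContinuum-9226) — line `covering-colipschitz`
# (crux-strategist s3: GLOBAL-INVERSE BULK RIGIDITY for the far field of the live line)

Registered ALTERNATIVE skeleton (never overwrites the live `Lines/mtp_prestress_split_ergodic_frame.lean`).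

## Idea

The live line (lead c3, `Cruxes/LayeredLawsSelectHcp/LeadC3FarField.md` §12–§14) is closed on the rigidity
half MODULO {G5 bulk rigidity, F2 finite certificate (LMI), F1′ law-level bookkeeping}, "G5 being the only piece
without a proof plan": the far field of the root-energy certificate needs, for every rooted labelled chart `X` of
an everywhere-`GoodShell` hcp-charted configuration, the RANGE FLOOR
`(17/20)·(9/10)·‖hcpSite 1 √(2/3) u‖ − C₅ ≤ ‖X u‖` (lead's G5, §12), and every discrete dead-reckoning proof
of it drifts (1-D chains lose a constant factor per frame transfer; `tube_farRange` reaches only `9/16`).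

LEVER (new on this crux): DO NOT WALK ALONG ATOMS — INVERT THE CHART GLOBALLY.  Interpolate `X` to a continuous
piecewise-affine map `F : ℝ³ → ℝ³` over the tetrahedral–octahedral honeycomb of the ideal hcp (octahedra cut
along one diagonal); on every ball of label-radius `1/6` the map `F` is within `3/20` (relative, Lipschitz
sense) of ONE similarity `a • A`, `a ≥ 9/10` — this is pure bookkeeping from the landed one-star lemmas
`tube_chartStarFrame` (1 % frames) and `tube_adjacentFrames` (5 % adjacent-frame coherence): the crude chain gives
`0.1097 < 3/20` (strategist numerics `kit/cells.py`, 56 cells of a vertex star, dual-basis sign-max bound; even the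
Frobenius × operator-norm bound gives `0.1425 < 3/20`).  Then a GLOBAL INVERSE FUNCTION THEOREM of Hadamard–John
type (uniformly locally `δ`-close to similarities of ratio `≥ m` on `r`-balls, `δ < 1` ⇒ `F` is a covering map of
`ℝ³`, hence — `ℝ³` simply connected, Mathlib `IsCoveringMap.existsUnique_continuousMap_lifts` — a homeomorphism,
and lifting straight segments gives the GLOBAL co-Lipschitz bound `‖F p − F q‖ ≥ (1−δ)·m·‖p − q‖`) yields the
PAIRWISE bulk range floor with NO additive constant:

  `BulkCoLipschitz (153/200)`:  `153/200 · dist (P u) (P w) ≤ dist (X u) (X w)` for ALL labels `u, w`,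

`153/200 = (1 − 3/20)·(9/10) = (17/20)·(9/10)` — exactly the lead's G5 constant with `C₅ = 0` (corollary
`tube_bulkRange_of_bulkCoLipschitz` below, in the lead's G5 shape).  No scale coherence, no Liouville rigidity, no
frame chaining beyond ONE step is used: space-filling charts cannot fold, and that alone gives the floor.

## Stubs (4) and composition

* `stub_selectionFloor` — VERBATIM the live line's selection core (shared; whoever proves it discharges both).
* `stub_globalInverse` — the global inverse function theorem for maps uniformly locally close to similarities
  (generic analysis over Mathlib; Hadamard / F. John 1968 "quasi-isometric mappings" / Plastock 1974).
* `stub_chartInterpolation` — the PL (Cauchy–Born) interpolation of a tube chart with local similarity defect `3/20`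
  on balls of radius `1/6` (inputs: `tube_chartStarFrame`, `tube_adjacentFrames`, both landed).
* `stub_tubeRigidityOfBulk` — the live line's remaining certificate programme (F2 + F1′) GIVEN the bulk ranges:
  `BulkCoLipschitz (153/200) →` law-level zero root-star defect (`Split.HcpTubeRigidity`, unbundled).

`bulkCoLipschitz_of` : S2 → S3 → `BulkCoLipschitz (153/200)` and
`LayeredLawsSelectHcp_of` : S1 → S2 → S3 → S4 → `LayeredLawsSelectHcp` are SORRY-FREE (glue = s1's landed
`Split.LayeredLawsSelectHcp_of_subs`).  Disproof obligations honoured: the energy hypothesis is kept in S1 and S4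
(`layeredLawsSelectHcp_false_without_energy`, `cubicRootNull_false_without_energy`); the crux's `−y` Mecke
convention (`Negative.DiracLaws.PointStationary`) is used throughout; no Bravais presentation of hcp is asserted.
[folklore]
-/

noncomputable section

namespace Summit.AtomisticToContinuum.Crystallization.Cruxes.LayeredLawsSelectHcp.CoveringCoLipschitz

open MeasureTheory Set Metric
open Literature.MathematicalPhysics.StatisticalMechanics Literature.Geometry.DiscreteGeometry
open Summit.AtomisticToContinuum.Crystallization.Theses.PalmUnimodularRigidity (LayeredLawsSelectHcp)
open Summit.AtomisticToContinuum.Crystallization.Theorems.LayeredLawsSelectHcp.Negative.DiracLaws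
  (PointStationary meanRootEnergy GoodShell Layered)
open Summit.AtomisticToContinuum.Crystallization.Theorems.PalmUnimodularRigidity.LayeredLawsSelectHcp
  (hcpE hcpSite hcpStarIdx starDefect HcpCharted HcpLayered cubicRoot IsRootedChart)
open Summit.AtomisticToContinuum.Crystallization.Cruxes.LayeredLawsSelectHcp.Split
  (SelectionFloor HcpTubeRigidity selectionFloor_iff hcpTubeRigidity_iff hcpE_eq_energyPerParticle
    LayeredLawsSelectHcp_of_subs)

/-- Euclidean `3`-space. [folklore] -/
local notation "E3" => EuclideanSpace ℝ (Fin 3)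

/-! ## The bulk range statement the line delivers -/

/-- **Pairwise bulk co-Lipschitz floor** for rooted labelled charts of everywhere-good hcp-charted configurations:
`θ · dist (P u) (P w) ≤ dist (X u) (X w)` for all labels (`P = hcpSite 1 √(2/3)`).  The line proves it for
`θ = 153/200` from S2 + S3. [folklore] -/
def BulkCoLipschitz (θ : ℝ) : Prop :=
  ∀ S : Set E3, (∀ x ∈ S, GoodShell S x) → HcpCharted S → ∀ X : ℤ × ℤ × ℤ → E3, IsRootedChart S X →
    ∀ u w : ℤ × ℤ × ℤ,
      θ * dist (hcpSite 1 (Real.sqrt (2 / 3)) u) (hcpSite 1 (Real.sqrt (2 / 3)) w) ≤ dist (X u) (X w)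

/-! ## The four registered stubs -/

/-- **S1 `stub_selectionFloor` (shared VERBATIM with the live line `mtp-prestress-split-ergodic-frame`)** — density-form
Hägg selection robust in the 1 % tube: no point-stationary layered law with mean root energy `≤ hcpE a₀ h₀` (the
relaxed cell, global minimiser of `hcpE` over the open quadrant) charges the event "the root is a cubic site".
Why plausibly true: hcp beats every other Hägg word for LJ beyond the second shell at fixed density (landed
`haggSelection`), and the tube's 1 % slack costs second order in energy but a fault costs first order per fault
layer; the honest risk is the law-level exchange of limits (lead memos c1 §5, c2).  Size XL. [folklore] -/
theorem stub_selectionFloor :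
    ∀ a₀ h₀ : ℝ, 189 / 200 ≤ a₀ → a₀ ≤ 199 / 200 → 77 / 100 ≤ h₀ → h₀ ≤ 163 / 200 →
      (∀ a h : ℝ, 0 < a → 0 < h → hcpE a₀ h₀ ≤ hcpE a h) →
      ∀ P : Measure (Measure E3), IsProbabilityMeasure P → PointStationary P → Layered P →
        meanRootEnergy P ≤ hcpE a₀ h₀ → P cubicRoot = 0 := by
  sorry

/-- **S2 `stub_globalInverse` — global inverse function theorem for maps uniformly locally close to similarities.**
If `F : ℝ³ → ℝ³` is, on EVERY ball of a fixed radius `r`, within relative Lipschitz defect `δ < 1` of a similarity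
`a • A` (`A` a linear isometry, ratio `a ≥ m > 0`, both allowed to depend on the ball), then `F` is a bijection of
`ℝ³` and GLOBALLY `(1 − δ) m`-co-Lipschitz.  Proof plan (Mathlib only): Banach fixed point on closed balls gives
`F (closedBall y s) ⊇ closedBall (F y) ((1−δ) a s)` for `s < r` and injectivity on `r`-balls; hence `F` is a
covering map with uniformly sized sheets (`IsOpen.trivializationDiscrete`), so by simple connectivity of `ℝ³`
(`IsCoveringMap.existsUnique_continuousMap_lifts` applied to `id` and to `F`) a homeomorphism; lifting the straight
segment `[F p, F q]` in steps of length `< (1−δ) m r / 2` bounds `‖p − q‖ ≤ ‖F p − F q‖ / ((1−δ) m)`.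
Hadamard's theorem (Krantz–Parks Thm 6.2.4) is the `C²` ancestor; F. John (CPAM 21, 1968) the quasi-isometric one.
Size M–L, pure analysis, no project imports needed. [folklore] -/
theorem stub_globalInverse :
    ∀ (F : E3 → E3) (r δ m : ℝ), 0 < r → 0 ≤ δ → δ < 1 → 0 < m →
      (∀ y : E3, ∃ a : ℝ, m ≤ a ∧ ∃ A : E3 ≃ₗᵢ[ℝ] E3,
        ∀ p ∈ Metric.ball y r, ∀ q ∈ Metric.ball y r, ‖(F p - F q) - a • (A p - A q)‖ ≤ δ * a * ‖p - q‖) →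
      Function.Bijective F ∧ ∀ p q : E3, (1 - δ) * m * ‖p - q‖ ≤ ‖F p - F q‖ := by
  sorry

/-- **S3 `stub_chartInterpolation` — the Cauchy–Born interpolant of a tube chart is locally `3/20`-close to a
similarity.**  For a rooted labelled chart `X` of an everywhere-good hcp-charted `S` there is `F : ℝ³ → ℝ³`
extending `X ∘ (hcpSite 1 √(2/3))⁻¹` such that on every ball of radius `1/6` (label units) `F − a • A` is
`(3/20)·a`-Lipschitz for some similarity with `9/10 ≤ a` (`≤ 1`).  Construction: the continuous piecewise-affine
interpolation over the tetrahedral–octahedral honeycomb of `hcpStacking 1 √(2/3)` with each octahedron cut into four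
tetrahedra along one fixed diagonal; every `1/6`-ball lies in the open star of a vertex `v` (Lebesgue radius
`h_min/4 = 1/(4√2) > 1/6`), and in the star of `v` every cell gradient is within `0.1097·a_v` (operator norm) of
`v`'s one-star frame `a_v A_v` (`tube_chartStarFrame` re-rooted at `v`: shell atoms to `a_v/100`; the antipode of
`v` in an octahedral cell through ONE adjacent frame, `tube_adjacentFrames`: `≤ (5/90 + 1/100 + 1/98)·a_v`; dual-basis
bound per cell type A/B/C = `0.0235 / 0.0316 / 0.1097`, strategist `kit/cells.py`).  Why it might fail: only by an
arithmetic slip — the margin to `3/20` absorbs even the Frobenius bound `0.1425`.  Size L (finite case analysis over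
the 3 cell types + the Lebesgue-radius lemma + "PL map is Lipschitz on a convex set with the max cell constant").
[folklore] -/
theorem stub_chartInterpolation :
    ∀ S : Set E3, (∀ x ∈ S, GoodShell S x) → HcpCharted S → ∀ X : ℤ × ℤ × ℤ → E3, IsRootedChart S X →
      ∃ F : E3 → E3, (∀ u : ℤ × ℤ × ℤ, F (hcpSite 1 (Real.sqrt (2 / 3)) u) = X u) ∧
        ∀ y : E3, ∃ a : ℝ, 9 / 10 ≤ a ∧ ∃ A : E3 ≃ₗᵢ[ℝ] E3,
          ∀ p ∈ Metric.ball y (1 / 6 : ℝ), ∀ q ∈ Metric.ball y (1 / 6 : ℝ),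
            ‖(F p - F q) - a • (A p - A q)‖ ≤ 3 / 20 * a * ‖p - q‖ := by
  sorry

/-- **S4 `stub_tubeRigidityOfBulk` — the live certificate programme GIVEN the bulk ranges.**  With the pairwise
floor `BulkCoLipschitz (153/200)` available for every rooted chart (this line's `bulkCoLipschitz_of`), the rigidity
half of the crux in its law-level form (s1's `Split.HcpTubeRigidity`, unbundled): for the relaxed cell `(a₀,h₀)`,
every point-stationary hcp-layered probability law with mean root energy `≤ e(hcp a₀ h₀)` has a.s. ZERO congruence
defect of the root star.  Proof plan = lead c3's F2 (finite near-field certificate at `(a₀,h₀)` by LMI, kit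
evidence CERT-P `0.1351`, j023179) + F1′ (polarisation, mean-zero correctors `stub_correctorMeanZero` p139851, Mecke,
`ε`-family tail `LeadC3FarField.md` §14(1)) + the far-field tax bound, which is where the ranges enter
(§12: "θ ≥ 0.85 relative to the local scale suffices: base tax `1.8·θ⁻¹⁰ ≤ 12`").  Why it might fail: the LMI
margin at the true cell may not absorb the far tax at `θ_abs = 0.765` if the budget needs `θ` relative to the ROOT
scale (scale drift `a_u/a_0 ∈ [9/10, 10/9]` is NOT controlled by this line — see the line card, Negation).  Size XL.
[folklore] -/
theorem stub_tubeRigidityOfBulk :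
    BulkCoLipschitz (153 / 200) →
      ∀ a₀ h₀ : ℝ, ∀ ha₀ : a₀ ≠ 0, ∀ hh₀ : h₀ ≠ 0, 189 / 200 ≤ a₀ → a₀ ≤ 199 / 200 → 77 / 100 ≤ h₀ →
        h₀ ≤ 163 / 200 →
        (∀ a h : ℝ, ∀ ha : a ≠ 0, ∀ hh : h ≠ 0, 0 < a → 0 < h →
          (hcpPeriodicConfiguration ha₀ hh₀).energyPerParticle lennardJones ≤
            (hcpPeriodicConfiguration ha hh).energyPerParticle lennardJones) →
        ∀ P : Measure (Measure E3), IsProbabilityMeasure P → PointStationary P → HcpLayered P →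
          meanRootEnergy P ≤ (hcpPeriodicConfiguration ha₀ hh₀).energyPerParticle lennardJones →
            ∀ᵐ μ ∂P, starDefect a₀ h₀ μ = 0 := by
  sorry

/-! ## Sorry-free composition -/

/-- **`bulkCoLipschitz_of` — S2 + S3 give the pairwise bulk floor `153/200 = (1 − 3/20)·(9/10)`.** [folklore] -/
theorem bulkCoLipschitz_of
    (h2 : ∀ (F : E3 → E3) (r δ m : ℝ), 0 < r → 0 ≤ δ → δ < 1 → 0 < m →
      (∀ y : E3, ∃ a : ℝ, m ≤ a ∧ ∃ A : E3 ≃ₗᵢ[ℝ] E3,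
        ∀ p ∈ Metric.ball y r, ∀ q ∈ Metric.ball y r, ‖(F p - F q) - a • (A p - A q)‖ ≤ δ * a * ‖p - q‖) →
      Function.Bijective F ∧ ∀ p q : E3, (1 - δ) * m * ‖p - q‖ ≤ ‖F p - F q‖)
    (h3 : ∀ S : Set E3, (∀ x ∈ S, GoodShell S x) → HcpCharted S → ∀ X : ℤ × ℤ × ℤ → E3, IsRootedChart S X →
      ∃ F : E3 → E3, (∀ u : ℤ × ℤ × ℤ, F (hcpSite 1 (Real.sqrt (2 / 3)) u) = X u) ∧
        ∀ y : E3, ∃ a : ℝ, 9 / 10 ≤ a ∧ ∃ A : E3 ≃ₗᵢ[ℝ] E3,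
          ∀ p ∈ Metric.ball y (1 / 6 : ℝ), ∀ q ∈ Metric.ball y (1 / 6 : ℝ),
            ‖(F p - F q) - a • (A p - A q)‖ ≤ 3 / 20 * a * ‖p - q‖) :
    BulkCoLipschitz (153 / 200) := by
  intro S hS hC X hX u w
  obtain ⟨F, hFX, hloc⟩ := h3 S hS hC X hX
  obtain ⟨-, hco⟩ := h2 F (1 / 6) (3 / 20) (9 / 10) (by norm_num) (by norm_num) (by norm_num) (by norm_num) hloc
  have h := hco (hcpSite 1 (Real.sqrt (2 / 3)) u) (hcpSite 1 (Real.sqrt (2 / 3)) w)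
  rw [hFX, hFX] at h
  rw [dist_eq_norm, dist_eq_norm]
  have : (1 - 3 / 20 : ℝ) * (9 / 10) = 153 / 200 := by norm_num
  rw [this] at h
  exact h

/-- **The lead's G5 with `C₅ = 0`** (shape of `LeadC3FarField.md` §12): `(17/20)·(9/10)·‖hcpSite 1 √(2/3) u‖ ≤ ‖X u‖`
for every rooted chart, from the pairwise floor at `w = 0` (`X 0 = 0`, `hcpSite 1 √(2/3) 0 = 0`). [folklore] -/
theorem tube_bulkRange_of_bulkCoLipschitz (h : BulkCoLipschitz (153 / 200)) :
    ∀ S : Set E3, (∀ x ∈ S, GoodShell S x) → HcpCharted S → ∀ X : ℤ × ℤ × ℤ → E3, IsRootedChart S X →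
      ∀ u : ℤ × ℤ × ℤ, 17 / 20 * (9 / 10) * ‖hcpSite 1 (Real.sqrt (2 / 3)) u‖ ≤ ‖X u‖ := by
  intro S hS hC X hX u
  have h0 : hcpSite 1 (Real.sqrt (2 / 3)) 0 = 0 := barlowPos_alternating_zero 1 (Real.sqrt (2 / 3))
  have hX0 : X 0 = 0 := hX.1
  have := h S hS hC X hX u 0
  rw [h0, hX0, dist_zero_right, dist_zero_right] at this
  have h153 : (17 / 20 * (9 / 10) : ℝ) = 153 / 200 := by norm_num
  rw [h153]
  exact this

/-- The `hcpE`-form selection core (S1, the live line's text) gives s1's `Split.SelectionFloor`. [folklore] -/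
theorem selectionFloor_of_hcpE
    (h1 : ∀ a₀ h₀ : ℝ, 189 / 200 ≤ a₀ → a₀ ≤ 199 / 200 → 77 / 100 ≤ h₀ → h₀ ≤ 163 / 200 →
      (∀ a h : ℝ, 0 < a → 0 < h → hcpE a₀ h₀ ≤ hcpE a h) →
      ∀ P : Measure (Measure E3), IsProbabilityMeasure P → PointStationary P → Layered P →
        meanRootEnergy P ≤ hcpE a₀ h₀ → P cubicRoot = 0) :
    SelectionFloor := by
  refine selectionFloor_iff.2 ?_
  intro a₀ h₀ ha₀ hh₀ ha₁ ha₂ hh₁ hh₂ hmin P hP hStat hLay hEn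
  have hmin' : ∀ a h : ℝ, 0 < a → 0 < h → hcpE a₀ h₀ ≤ hcpE a h := by
    intro a h ha hh
    rw [hcpE_eq_energyPerParticle ha₀ hh₀, hcpE_eq_energyPerParticle ha.ne' hh.ne']
    exact hmin a h ha.ne' hh.ne' ha hh
  have hEn' : meanRootEnergy P ≤ hcpE a₀ h₀ := by
    rw [hcpE_eq_energyPerParticle ha₀ hh₀]; exact hEn
  exact h1 a₀ h₀ ha₁ ha₂ hh₁ hh₂ hmin' P hP hStat hLay hEn'

/-- **`LayeredLawsSelectHcp_of` — the crux BY NAME from the four stubs (sorry-free glue).**  S1 gives the selection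
core, S2+S3 the bulk ranges, S4 the rigidity core from the ranges, and s1's landed split glue
`Split.LayeredLawsSelectHcp_of_subs` closes `Summit.AtomisticToContinuum.Crystallization.Theses.PalmUnimodularRigidity.LayeredLawsSelectHcp`.
[folklore] -/
theorem LayeredLawsSelectHcp_of
    (h1 : ∀ a₀ h₀ : ℝ, 189 / 200 ≤ a₀ → a₀ ≤ 199 / 200 → 77 / 100 ≤ h₀ → h₀ ≤ 163 / 200 →
      (∀ a h : ℝ, 0 < a → 0 < h → hcpE a₀ h₀ ≤ hcpE a h) →
      ∀ P : Measure (Measure E3), IsProbabilityMeasure P → PointStationary P → Layered P →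
        meanRootEnergy P ≤ hcpE a₀ h₀ → P cubicRoot = 0)
    (h2 : ∀ (F : E3 → E3) (r δ m : ℝ), 0 < r → 0 ≤ δ → δ < 1 → 0 < m →
      (∀ y : E3, ∃ a : ℝ, m ≤ a ∧ ∃ A : E3 ≃ₗᵢ[ℝ] E3,
        ∀ p ∈ Metric.ball y r, ∀ q ∈ Metric.ball y r, ‖(F p - F q) - a • (A p - A q)‖ ≤ δ * a * ‖p - q‖) →
      Function.Bijective F ∧ ∀ p q : E3, (1 - δ) * m * ‖p - q‖ ≤ ‖F p - F q‖)
    (h3 : ∀ S : Set E3, (∀ x ∈ S, GoodShell S x) → HcpCharted S → ∀ X : ℤ × ℤ × ℤ → E3, IsRootedChart S X →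
      ∃ F : E3 → E3, (∀ u : ℤ × ℤ × ℤ, F (hcpSite 1 (Real.sqrt (2 / 3)) u) = X u) ∧
        ∀ y : E3, ∃ a : ℝ, 9 / 10 ≤ a ∧ ∃ A : E3 ≃ₗᵢ[ℝ] E3,
          ∀ p ∈ Metric.ball y (1 / 6 : ℝ), ∀ q ∈ Metric.ball y (1 / 6 : ℝ),
            ‖(F p - F q) - a • (A p - A q)‖ ≤ 3 / 20 * a * ‖p - q‖)
    (h4 : BulkCoLipschitz (153 / 200) →
      ∀ a₀ h₀ : ℝ, ∀ ha₀ : a₀ ≠ 0, ∀ hh₀ : h₀ ≠ 0, 189 / 200 ≤ a₀ → a₀ ≤ 199 / 200 → 77 / 100 ≤ h₀ →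
        h₀ ≤ 163 / 200 →
        (∀ a h : ℝ, ∀ ha : a ≠ 0, ∀ hh : h ≠ 0, 0 < a → 0 < h →
          (hcpPeriodicConfiguration ha₀ hh₀).energyPerParticle lennardJones ≤
            (hcpPeriodicConfiguration ha hh).energyPerParticle lennardJones) →
        ∀ P : Measure (Measure E3), IsProbabilityMeasure P → PointStationary P → HcpLayered P →
          meanRootEnergy P ≤ (hcpPeriodicConfiguration ha₀ hh₀).energyPerParticle lennardJones →
            ∀ᵐ μ ∂P, starDefect a₀ h₀ μ = 0) :
    LayeredLawsSelectHcp :=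
  LayeredLawsSelectHcp_of_subs (selectionFloor_of_hcpE h1) (hcpTubeRigidity_iff.2 (h4 (bulkCoLipschitz_of h2 h3)))

/-- The crux BY NAME from the registered stubs (depends on the four `sorry`s above and on nothing else). [folklore] -/
theorem LayeredLawsSelectHcp_of_stubs : LayeredLawsSelectHcp :=
  LayeredLawsSelectHcp_of stub_selectionFloor stub_globalInverse stub_chartInterpolation stub_tubeRigidityOfBulk

end Summit.AtomisticToContinuum.Crystallization.Cruxes.LayeredLawsSelectHcp.CoveringCoLipschitz

end
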